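import Summits.AtomisticToContinuum.Crystallization.Theorems.ExcessDecayLiouvilleLinearDecay
import Summits.AtomisticToContinuum.Crystallization.Theorems.ExcessDecayLiouvilleRelaxationNewton
import Summits.AtomisticToContinuum.Crystallization.Theorems.ExcessDecayLiouvilleTaylorJump
import Summits.AtomisticToContinuum.Crystallization.Theorems.ExcessDecayLiouvilleNaturalForceLipschitz
import Summits.AtomisticToContinuum.Crystallization.Theorems.ExcessDecayLiouvilleStepDecayPrelims

/-!
# Route `ExcessDecayLiouville`: the decay step — Taylor data, optical jump, relaxation (nonlinear half, XVI)

Harmonic-replacement architecture for item `ExcessDecay` (stmt-AtomisticToContinuum-9334), nonlinear half.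
Abstract form of the second half of one step.  Input: a finitely supported field `h` with ZERO rows on
`B_{ρh}(c₀)`, `ρh = 2(1280·9ρ + 2388) + 4` (the harmonic replacement `v + w` of `step_compare`), and the
current RELAXED affine-plus-shift approximant `aff` (data `a, Bm`, base `c₀`).  Output (`step_decay`):
the Taylor data `(z₀, aᵀ, Bᵀ)` of `linear_decay` at `r' = 9ρ` with its pointwise error bound at all radii
`≤ ρ`, the optical jump bound of `taylor_jump_le`, and the relaxation shift `ξ` of `exists_relaxed_field`
for `aff + T`, bounded through `norm_natForce_sub_le`; the new approximant `aff + T + 𝟙_{S₀} ξ` is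
relaxed, with explicit data based at `c₀`.
All `[folklore]`; helper lemmas, nothing here closes an item.
-/

noncomputable section

namespace Summit.AtomisticToContinuum.Crystallization.Theorems.ExcessDecayLiouville

open scoped BigOperators Topology InnerProductSpace RealInnerProductSpace Classical
open Literature.MathematicalPhysics.StatisticalMechanics
open Summit.AtomisticToContinuum.Crystallization.Theorems.PhononStabilityNegative

local notation "E3" => EuclideanSpace ℝ (Fin 3)

-- Local notation: the force-constant map `K(e)w = h(|e|²)w + 2⟪e,w⟫h′(|e|²)e` (`= forceConst e w`).
local notation3 "𝕂[" e "] " w:max =>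
  (-((‖e‖ ^ 2)⁻¹) ^ 7 + ((‖e‖ ^ 2)⁻¹) ^ 4) • w + (2 * ⟪e, w⟫ * (7 * ((‖e‖ ^ 2)⁻¹) ^ 8 - 4 * ((‖e‖ ^ 2)⁻¹) ^ 5)) • e
-- Local notation: the pair force `F(x) = h(|x|²) x`.
local notation3 "𝐅[" x "]" => ((-((‖x‖ ^ 2)⁻¹) ^ 7 + ((‖x‖ ^ 2)⁻¹) ^ 4) • x)
set_option quotPrecheck false in
-- Local notation: ball indicator.
local notation "𝟙ᵇ[" x ", " c ", " R "]" => (if dist (x : EuclideanSpace ℝ (Fin 3)) c ≤ R then (1 : ℝ) else 0)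
-- Local notation: lattice basis.
local notation "𝐮₁" => (triangularVec₁ 1 : EuclideanSpace ℝ (Fin 3))
local notation "𝐮₂" => (triangularVec₂ 1 : EuclideanSpace ℝ (Fin 3))
local notation "𝐰₃" => (layerNormal (2 * Real.sqrt (2 / 3)) : EuclideanSpace ℝ (Fin 3))
-- the constants of one level in mass form
local notation "Cₐ" => (19 * (1024 / ((23 / 25 : ℝ) ^ 3 * (23 / 25 : ℝ) ^ 3)) + 38 * (1024 / (23 / 25 : ℝ) ^ 3))
local notation "Cⱼ" => (9961472 : ℝ)

section

variable {t : Fin 2 → E3} {A : E3 →L[ℝ] E3} {c₀ : E3} {κ : ℝ}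

set_option quotPrecheck false in
-- Local notation: the operator row `(L v)(p)`.
local notation "𝕃" v:max " @ " p:max =>
  tsum (fun q : Sites₀ t A => (if ((p : Sites₀ t A) : E3) ≠ q then 𝕂[((p : Sites₀ t A) : E3) - q] (v ((p : Sites₀ t A) : E3) - v q) else 0))
set_option quotPrecheck false in
-- local mass on the ball of radius `X` about `c₀`
local notation "𝐌[" f ", " X "]" =>
  tsum (fun p : Sites₀ t A => ‖f (p : EuclideanSpace ℝ (Fin 3))‖ ^ 2 * 𝟙ᵇ[p, c₀, X])
set_option quotPrecheck false in
-- weighted far mass with floor `Y` about `c₀`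
local notation "𝐉[" f ", " Y "]" =>
  tsum (fun q : Sites₀ t A => ‖f (q : EuclideanSpace ℝ (Fin 3))‖ ^ 2 * (max (dist (q : EuclideanSpace ℝ (Fin 3)) c₀) Y)⁻¹ ^ 8)
set_option quotPrecheck false in
-- lattice difference
local notation "Δ[" τ "] " f:max => (fun x : EuclideanSpace ℝ (Fin 3) => f (x + A τ) - f x)
set_option quotPrecheck false in
-- the level constant `L = (4Cₐ + 24Cⱼ)/κ + 1`
local notation "𝐋" => ((4 * Cₐ + 24 * Cⱼ) / κ + 1)
set_option quotPrecheck false in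
-- the gradient far mass
local notation "𝐉Δ[" h ", " Y "]" => (𝐉[Δ[𝐮₁] h, Y] + 𝐉[Δ[𝐮₂] h, Y] + 𝐉[Δ[𝐰₃] h, Y])
set_option quotPrecheck false in
-- Local notation: the displaced self-force `G(p)` of the background `aff`.
local notation "𝐆[" aff "] " p:max =>
  tsum (fun q : Sites₀ t A => (if (p : E3) ≠ q then 𝐅[((p : E3) - q) + (aff (p : E3) - aff q)] else 0))
set_option quotPrecheck false in
-- Local notation: the natural force `Ψ_B(s)` at `t 0`.
local notation "𝚿[" B ", " s "]" =>
  tsum (fun q : Sites₀ t A => (if (t 0 : E3) ≠ q then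
    𝐅[((t 0 : E3) - q) + (B ((t 0 : E3) - q) + (if (∃ z ∈ Λ₀, (q : E3) = t 1 + A z) then s else 0))] else 0))
-- the two Lipschitz constants of the natural force
local notation "Cˢ" => (38 * (25 / 23) * (1024 / ((23 / 25 : ℝ) ^ 3 * (23 / 25 : ℝ) ^ 4)) +
  (1024 / ((23 / 25 : ℝ) ^ 3 * (23 / 25 : ℝ) ^ 4)) * ((25 / 23 : ℝ) ^ 2 * (72 + 2000)))
local notation "Cᴮ" => (5660 * (1024 / ((23 / 25 : ℝ) ^ 3 * (23 / 25 : ℝ) ^ 3)))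

/-- **Taylor part of the decay step**: `linear_decay` at `r' = 9ρ` with zero right-hand side, the slope
bound `‖Bᵀ‖ ≤ 12√Θ₁`, the values of the Taylor data, and the pointwise error. [folklore] -/
theorem step_decay_taylor (hA : Adm₀ A) (hI : Inner₀ t A) (hκ0 : 0 < κ)
    (hκ : ∀ v : E3 → E3, (Function.support v).Finite → Function.support v ⊆ Sites₀ t A →
      κ * nnForm t A v ≤ ∑' p : Sites₀ t A, ⟪𝕃 v @ p, v p⟫)
    {h : E3 → E3} (hh : (Function.support h).Finite) {ρ : ℝ} (hρ : 64 ≤ ρ)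
    (hrows : ∀ p : Sites₀ t A, dist (p : E3) c₀ ≤ 2 * (1280 * (9 * ρ) + 2388) + 4 → 𝕃 h @ p = 0)
    {V : ℝ} (hV : ∀ x ∈ Sites₀ t A, dist x c₀ ≤ 11 / 5 → ‖h x‖ ≤ V)
    {Θ₁ Θ₂ : ℝ}
    (hΘ₁ : 64 * 𝐋 ^ 3 / (9 * ρ) ^ 3 * (𝐋 * (𝐌[h, 4 * (1280 * (9 * ρ) + 2388) + 4] / (1280 * (9 * ρ) + 2388) ^ 2 +
        𝐉[h, 10 * (9 * ρ) + 10])) + 536 * 𝐋 ^ 3 * (9 * ρ) ^ 3 * 𝐉Δ[h, 10 * (9 * ρ) + 10] ≤ Θ₁)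
    (hΘ₂ : 64 * 𝐋 ^ 4 / (9 * ρ) ^ 5 * (𝐋 * (𝐌[h, 4 * (1280 * (9 * ρ) + 2388) + 4] / (1280 * (9 * ρ) + 2388) ^ 2 +
        𝐉[h, 10 * (9 * ρ) + 10])) + (64 * 𝐋 ^ 4 / (9 * ρ) ^ 3 + 3216 * 𝐋 ^ 4 * (9 * ρ) ^ 3) * 𝐉Δ[h, 10 * (9 * ρ) + 10] ≤ Θ₂)
    (hΘ₂0 : 0 ≤ Θ₂) :
    ∃ (z₀ : E3) (aT : Fin 2 → E3) (BT : E3 →L[ℝ] E3), z₀ ∈ Λ₀ ∧ dist (t 0 + A z₀) c₀ ≤ 11 / 10 ∧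
      ‖BT‖ ≤ 12 * Real.sqrt Θ₁ ∧ aT 0 = h (t 0 + A z₀) ∧ (∀ m, ‖aT m‖ ≤ V + 11 / 10 * ‖BT‖) ∧
      (∀ (m : Fin 2) (z : E3), z ∈ Λ₀ →
        (fun x : E3 => (if (∃ z ∈ Λ₀, x = t 1 + A z) then aT 1 else aT 0) + BT (x - (t 0 + A z₀))) (t m + A z) =
          aT m + BT (t m + A z - (t 0 + A z₀))) ∧
      (∀ (L : ℝ) (N : ℕ), 400 / 189 * (L + 11 / 5) ≤ N → 4 * (N : ℝ) + 11 ≤ 9 * ρ →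
        ∀ (m : Fin 2) (z : E3), z ∈ Λ₀ → dist (t m + A z) c₀ ≤ L →
          ‖h (t m + A z) - (aT m + BT (t m + A z - (t 0 + A z₀)))‖ ^ 2 ≤ 144 * (N : ℝ) ^ 4 * Θ₂) ∧
      (∀ x ∈ Sites₀ t A, x ≠ t 0 + A z₀ → dist x c₀ ≤ ρ →
        ‖h x - ((fun x : E3 => (if (∃ z ∈ Λ₀, x = t 1 + A z) then aT 1 else aT 0) + BT (x - (t 0 + A z₀))) x)‖ ≤
          1428 * Real.sqrt Θ₂ * (dist x (t 0 + A z₀)) ^ 2) := by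
  have hr' : (2 : ℝ) ≤ 9 * ρ := by linarith
  have hwork : (∑' p : Sites₀ t A, (if (p : E3) ∈ Sites₀ t A then
      max (min 1 (((1280 * (9 * ρ) + 2388) + 2 + (1280 * (9 * ρ) + 2388) - dist (p : E3) c₀) / (1280 * (9 * ρ) + 2388))) 0
        else 0) ^ 2 * ⟪(fun _ : E3 => (0 : E3)) (p : E3), h (p : E3)⟫) ≤ 0 := by
    simp only [inner_zero_left, mul_zero, tsum_zero, le_refl]
  obtain ⟨z₀, hz₀, hp₀c, aT, BT, hB2, ha0, ha1, htay⟩ := linear_decay hA hI hκ0 hκ hh hr' le_rfl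
    (Gf := fun _ => (0 : E3)) (fun _ _ _ => rfl) hrows hwork (c₀ := c₀)
  -- the slope
  have hBT : ‖BT‖ ≤ 12 * Real.sqrt Θ₁ := by
    have h1 : ‖BT‖ ^ 2 ≤ 144 * Θ₁ := hB2.trans (mul_le_mul_of_nonneg_left hΘ₁ (by norm_num))
    calc ‖BT‖ = Real.sqrt (‖BT‖ ^ 2) := (Real.sqrt_sq (norm_nonneg _)).symm
      _ ≤ Real.sqrt (144 * Θ₁) := Real.sqrt_le_sqrt h1
      _ = 12 * Real.sqrt Θ₁ := by
          rw [Real.sqrt_mul (by norm_num), show (144 : ℝ) = 12 ^ 2 by norm_num, Real.sqrt_sq (by norm_num)]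
  -- the Taylor field on the sites
  have hT : ∀ (m : Fin 2) (z : E3), z ∈ Λ₀ →
      (fun x : E3 => (if (∃ z ∈ Λ₀, x = t 1 + A z) then aT 1 else aT 0) + BT (x - (t 0 + A z₀))) (t m + A z) =
        aT m + BT (t m + A z - (t 0 + A z₀)) := by
    intro m z hz
    simp only []
    obtain hm | hm := (Fin.exists_fin_two.mp ⟨m, rfl⟩ : m = 0 ∨ m = 1)
    · rw [hm, if_neg]
      rintro ⟨z', hz', h'⟩
      exact sublattice_ne hA hI hz hz' h'
    · rw [hm, if_pos ⟨z, hz, rfl⟩]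
  -- the Taylor bound with Θ₂
  have htay' : ∀ (L : ℝ) (N : ℕ), 400 / 189 * (L + 11 / 5) ≤ N → 4 * (N : ℝ) + 11 ≤ 9 * ρ →
      ∀ (m : Fin 2) (z : E3), z ∈ Λ₀ → dist (t m + A z) c₀ ≤ L →
        ‖h (t m + A z) - (aT m + BT (t m + A z - (t 0 + A z₀)))‖ ^ 2 ≤ 144 * (N : ℝ) ^ 4 * Θ₂ := by
    intro L N hN hN' m z hz hd
    refine (htay L N hN hN' m z hz hd).trans ?_
    have : 0 ≤ 144 * (N : ℝ) ^ 4 := by positivity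
    exact mul_le_mul_of_nonneg_left hΘ₂ this
  -- pointwise error
  have hpt := taylor_error_pointwise hA hI
    (fun x => h x - ((fun x : E3 => (if (∃ z ∈ Λ₀, x = t 1 + A z) then aT 1 else aT 0) + BT (x - (t 0 + A z₀))) x))
    (add_mem_sites₀ t0_mem_sites hz₀) hp₀c hρ hΘ₂0 (fun L N hN hN' m z hz hd => by
      have h1 := htay' L N hN hN' m z hz hd
      have h2 := hT m z hz
      simp only [] at h2 ⊢
      rwa [h2])
  -- values of the Taylor data
  have hp₁c : dist (t 1 + A z₀) c₀ ≤ 11 / 5 := by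
    have h1 : dist (t 1 + A z₀) (t 0 + A z₀) ≤ 11 / 10 := by
      rw [dist_eq_norm, show t 1 + A z₀ - (t 0 + A z₀) = t 1 - t 0 by abel]; exact norm_t_sub_t_le hA hI
    have := dist_triangle (t 1 + A z₀) (t 0 + A z₀) c₀; linarith
  have hBn : 0 ≤ ‖BT‖ := norm_nonneg _
  have hval0 : ‖aT 0‖ ≤ V + 11 / 10 * ‖BT‖ := by
    rw [ha0]
    have := hV _ (add_mem_sites₀ t0_mem_sites hz₀) (by linarith)
    linarith
  have ht1 : t 1 ∈ Sites₀ t A := ⟨1, 0, zero_mem_Λ₀, by rw [map_zero, add_zero]⟩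
  have hval1 : ‖aT 1‖ ≤ V + 11 / 10 * ‖BT‖ := by
    rw [ha1]
    have h1 := hV _ (add_mem_sites₀ ht1 hz₀) hp₁c
    have h2 : ‖BT (t 1 - t 0)‖ ≤ ‖BT‖ * (11 / 10) :=
      (BT.le_opNorm _).trans (mul_le_mul_of_nonneg_left (norm_t_sub_t_le hA hI) hBn)
    calc ‖h (t 1 + A z₀) - BT (t 1 - t 0)‖ ≤ ‖h (t 1 + A z₀)‖ + ‖BT (t 1 - t 0)‖ := norm_sub_le _ _
      _ ≤ V + 11 / 10 * ‖BT‖ := by linarith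
  have hval : ∀ m, ‖aT m‖ ≤ V + 11 / 10 * ‖BT‖ := by
    intro m
    obtain hm | hm := (Fin.exists_fin_two.mp ⟨m, rfl⟩ : m = 0 ∨ m = 1)
    · rw [hm]; exact hval0
    · rw [hm]; exact hval1
  exact ⟨z₀, aT, BT, hz₀, hp₀c, hBT, ha0, hval, hT, htay', hpt⟩

/-- The field `aff + T` is affine-plus-shift with slope `Bm + Bᵀ` and values
`ag m = a m + aᵀ m + Bᵀ(c₀ − p₀)`, base `c₀`. [folklore] -/
theorem affine_add_taylor (hA : Adm₀ A) (hI : Inner₀ t A) {z₀ : E3}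
    {aff : E3 → E3} {a : Fin 2 → E3} {Bm : E3 →L[ℝ] E3}
    (haff : ∀ (m : Fin 2) (z : E3), z ∈ Λ₀ → aff (t m + A z) = a m + Bm (t m + A z - c₀))
    (aT : Fin 2 → E3) (BT : E3 →L[ℝ] E3) (ag : Fin 2 → E3) (hag : ∀ m, ag m = a m + aT m + BT (c₀ - (t 0 + A z₀))) :
    ∀ (m : Fin 2) (z : E3), z ∈ Λ₀ →
      (fun x : E3 => aff x + ((if (∃ z ∈ Λ₀, x = t 1 + A z) then aT 1 else aT 0) + BT (x - (t 0 + A z₀)))) (t m + A z) =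
        ag m + (Bm + BT) (t m + A z - c₀) := by
  intro m z hz
  have hTm : (if (∃ z' ∈ Λ₀, t m + A z = t 1 + A z') then aT 1 else aT 0) = aT m := by
    obtain hm | hm := (Fin.exists_fin_two.mp ⟨m, rfl⟩ : m = 0 ∨ m = 1)
    · rw [hm, if_neg]
      rintro ⟨z', hz', h'⟩
      exact sublattice_ne hA hI hz hz' h'
    · rw [hm, if_pos ⟨z, hz, rfl⟩]
  simp only []
  rw [hTm, haff m z hz, hag m, show (Bm + BT) (t m + A z - c₀) = Bm (t m + A z - c₀) + BT (t m + A z - c₀) from rfl,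
    show t m + A z - (t 0 + A z₀) = (t m + A z - c₀) + (c₀ - (t 0 + A z₀)) by abel, map_add]
  abel

/-- **The self-force of `aff + T`** at `t 0`: for a relaxed `aff`, by `norm_natForce_sub_le`,
`‖G[aff + T](t 0)‖ ≤ Cˢ ‖aᵀ 0 − aᵀ 1‖ + Cᴮ ‖Bᵀ‖`. [folklore] -/
theorem selfForce_add_taylor_le (hA : Adm₀ A) (hI : Inner₀ t A) (hκ1 : κ ≤ 1) {z₀ : E3}
    {aff : E3 → E3} {a : Fin 2 → E3} {Bm : E3 →L[ℝ] E3}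
    (haff : ∀ (m : Fin 2) (z : E3), z ∈ Λ₀ → aff (t m + A z) = a m + Bm (t m + A z - c₀))
    (hrel : ∀ p : Sites₀ t A, 𝐆[aff] p = 0)
    (hBm : ‖Bm‖ ≤ κ / (2 * 10 ^ 10)) (ha : ‖a 0 - a 1‖ ≤ κ / (2 * 10 ^ 10))
    (aT : Fin 2 → E3) (BT : E3 →L[ℝ] E3) (ag : Fin 2 → E3) (hag : ∀ m, ag m = a m + aT m + BT (c₀ - (t 0 + A z₀)))
    (hBT : ‖BT‖ ≤ κ / (2 * 10 ^ 10)) (haT : ‖aT 0 - aT 1‖ ≤ κ / (2 * 10 ^ 10))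
    (hgt : ∀ (m : Fin 2) (z : E3), z ∈ Λ₀ →
      (fun x : E3 => aff x + ((if (∃ z ∈ Λ₀, x = t 1 + A z) then aT 1 else aT 0) + BT (x - (t 0 + A z₀)))) (t m + A z) =
        ag m + (Bm + BT) (t m + A z - c₀)) :
    ‖Bm + BT‖ ≤ κ / 10 ^ 10 ∧ ‖ag 0 - ag 1‖ ≤ κ / 10 ^ 10 ∧
    ‖𝐆[fun x : E3 => aff x + ((if (∃ z ∈ Λ₀, x = t 1 + A z) then aT 1 else aT 0) + BT (x - (t 0 + A z₀)))]
      (⟨t 0, t0_mem_sites⟩ : Sites₀ t A)‖ ≤ Cˢ * ‖aT 0 - aT 1‖ + Cᴮ * ‖BT‖ := by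
  have hB' : ‖Bm + BT‖ ≤ κ / 10 ^ 10 := (norm_add_le _ _).trans (by linarith)
  have hag01 : ag 0 - ag 1 = (a 0 - a 1) + (aT 0 - aT 1) := by rw [hag 0, hag 1]; abel
  have hs' : ‖ag 0 - ag 1‖ ≤ κ / 10 ^ 10 := by
    rw [hag01]; exact (norm_add_le _ _).trans (by linarith)
  refine ⟨hB', hs', ?_⟩
  have hκs : κ / 10 ^ 10 ≤ 1 / 200 := by
    rw [div_le_div_iff₀ (by positivity) (by norm_num)]; linarith
  have hG0 : 𝐆[aff] (⟨t 0, t0_mem_sites⟩ : Sites₀ t A) = 𝚿[Bm, a 0 - a 1] := dispForce_zero_eq_natForce hA hI haff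
  have hGt := dispForce_zero_eq_natForce hA hI
    (aff := fun x : E3 => aff x + ((if (∃ z ∈ Λ₀, x = t 1 + A z) then aT 1 else aT 0) + BT (x - (t 0 + A z₀))))
    (a := ag) (B := Bm + BT) (x₀ := c₀) hgt
  have hΨ0 : 𝚿[Bm, a 0 - a 1] = 0 := by rw [← hG0]; exact hrel _
  rw [hGt]
  have hsub := norm_natForce_sub_le hA hI (B := Bm) (B' := Bm + BT) (hBm.trans (by linarith)) (hB'.trans hκs)
    (s := a 0 - a 1) (s' := ag 0 - ag 1) (ha.trans (by linarith)) (hs'.trans hκs) (t := t) (A := A)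
  rw [hΨ0, sub_zero] at hsub
  have e1 : ag 0 - ag 1 - (a 0 - a 1) = aT 0 - aT 1 := by rw [hag01]; abel
  rw [e1, add_sub_cancel_left] at hsub
  exact hsub

/-- **Relaxation part of the decay step**: the optical jump of the Taylor data (`taylor_jump_le`) and the
relaxation of `aff + T` (`exists_relaxed_field`). [folklore] -/
theorem step_decay_relax (hA : Adm₀ A) (hI : Inner₀ t A) (hκ0 : 0 < κ) (hκ1 : κ ≤ 1)
    (hκ : ∀ v : E3 → E3, (Function.support v).Finite → Function.support v ⊆ Sites₀ t A →
      κ * nnForm t A v ≤ ∑' p : Sites₀ t A, ⟪𝕃 v @ p, v p⟫)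
    {h : E3 → E3} (hh : (Function.support h).Finite) {ρ : ℝ} (hρ : 64 ≤ ρ)
    {z₀ : E3} (hz₀ : z₀ ∈ Λ₀) (hp₀c : dist (t 0 + A z₀) c₀ ≤ 11 / 10)
    (hrow0 : 𝕃 h @ (⟨t 0 + A z₀, add_mem_sites₀ t0_mem_sites hz₀⟩ : Sites₀ t A) = 0)
    {J : ℝ} (hJ : 𝐉[h, ρ] ≤ J)
    {aff : E3 → E3} {a : Fin 2 → E3} {Bm : E3 →L[ℝ] E3}
    (haff : ∀ (m : Fin 2) (z : E3), z ∈ Λ₀ → aff (t m + A z) = a m + Bm (t m + A z - c₀))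
    (hrel : ∀ p : Sites₀ t A, 𝐆[aff] p = 0)
    (hBm : ‖Bm‖ ≤ κ / (2 * 10 ^ 10)) (ha : ‖a 0 - a 1‖ ≤ κ / (2 * 10 ^ 10))
    (aT : Fin 2 → E3) (BT : E3 →L[ℝ] E3) (ha0 : aT 0 = h (t 0 + A z₀)) {K Vₐ : ℝ} (hK : 0 ≤ K)
    (hVa : ∀ m, ‖aT m‖ ≤ Vₐ)
    (hT : ∀ (m : Fin 2) (z : E3), z ∈ Λ₀ →
      (fun x : E3 => (if (∃ z ∈ Λ₀, x = t 1 + A z) then aT 1 else aT 0) + BT (x - (t 0 + A z₀))) (t m + A z) =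
        aT m + BT (t m + A z - (t 0 + A z₀)))
    (hpt : ∀ x ∈ Sites₀ t A, x ≠ t 0 + A z₀ → dist x c₀ ≤ ρ →
      ‖h x - ((fun x : E3 => (if (∃ z ∈ Λ₀, x = t 1 + A z) then aT 1 else aT 0) + BT (x - (t 0 + A z₀))) x)‖ ≤
        K * (dist x (t 0 + A z₀)) ^ 2)
    (hBT : ‖BT‖ ≤ κ / (2 * 10 ^ 10))
    (hs₂ : 2 / κ * (38 * (1024 / ((23 / 25 : ℝ) ^ 3 * (23 / 25 : ℝ) ^ 4)) * ‖BT‖ +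
      38 * (1024 / ((23 / 25 : ℝ) ^ 3 * (23 / 25 : ℝ) ^ 3)) * K +
      38 * (1024 / ((23 / 25 : ℝ) ^ 3 * (ρ - 11 / 10) ^ 5)) * Vₐ +
      38 * (1024 / ((23 / 25 : ℝ) ^ 3 * (ρ - 11 / 10) ^ 4)) * ‖BT‖ +
      38 * Real.sqrt (1024 / ((23 / 25 : ℝ) ^ 3 * (ρ - 11 / 10) ^ 5)) * Real.sqrt (39 * J)) ≤ κ / (2 * 10 ^ 10))
    (hs₃ : Cˢ * (κ / (2 * 10 ^ 10)) + Cᴮ * ‖BT‖ ≤ κ ^ 2 / 10 ^ 11) :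
    ∃ ξ : E3,
      ‖aT 0 - aT 1‖ ≤ 2 / κ * (38 * (1024 / ((23 / 25 : ℝ) ^ 3 * (23 / 25 : ℝ) ^ 4)) * ‖BT‖ +
        38 * (1024 / ((23 / 25 : ℝ) ^ 3 * (23 / 25 : ℝ) ^ 3)) * K +
        38 * (1024 / ((23 / 25 : ℝ) ^ 3 * (ρ - 11 / 10) ^ 5)) * Vₐ +
        38 * (1024 / ((23 / 25 : ℝ) ^ 3 * (ρ - 11 / 10) ^ 4)) * ‖BT‖ +
        38 * Real.sqrt (1024 / ((23 / 25 : ℝ) ^ 3 * (ρ - 11 / 10) ^ 5)) * Real.sqrt (39 * J)) ∧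
      ‖ξ‖ ≤ 4 / κ * (Cˢ * ‖aT 0 - aT 1‖ + Cᴮ * ‖BT‖) ∧
      (∀ (m : Fin 2) (z : E3), z ∈ Λ₀ →
        (fun x : E3 => aff x + ((if (∃ z ∈ Λ₀, x = t 1 + A z) then aT 1 else aT 0) + BT (x - (t 0 + A z₀))) +
          (if (∃ z ∈ Λ₀, x = t 0 + A z) then ξ else 0)) (t m + A z) =
          (![a 0 + aT 0 + BT (c₀ - (t 0 + A z₀)) + ξ, a 1 + aT 1 + BT (c₀ - (t 0 + A z₀))] : Fin 2 → E3) m +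
            (Bm + BT) (t m + A z - c₀)) ∧
      (∀ p : Sites₀ t A, 𝐆[fun x : E3 => aff x + ((if (∃ z ∈ Λ₀, x = t 1 + A z) then aT 1 else aT 0) + BT (x - (t 0 + A z₀))) +
          (if (∃ z ∈ Λ₀, x = t 0 + A z) then ξ else 0)] p = 0) := by
  have hρ3 : (3 : ℝ) ≤ ρ := by linarith
  -- (1) the jump
  have hjump := taylor_jump_le hA hI hκ0 hκ hh hz₀ hp₀c hrow0 aT BT _ hT ha0 hK hρ3 hVa hpt hJ
  have hjump' : ‖aT 0 - aT 1‖ ≤ κ / (2 * 10 ^ 10) := hjump.trans hs₂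
  -- (2) the combined affine data
  obtain ⟨ag, hagdef⟩ : ∃ ag : Fin 2 → E3, ag = fun m => a m + aT m + BT (c₀ - (t 0 + A z₀)) := ⟨_, rfl⟩
  have hag : ∀ m, ag m = a m + aT m + BT (c₀ - (t 0 + A z₀)) := fun m => by rw [hagdef]
  have hgt := affine_add_taylor hA hI haff aT BT ag hag (z₀ := z₀)
  obtain ⟨hB', hs', hGn⟩ := selfForce_add_taylor_le hA hI hκ1 haff hrel hBm ha aT BT ag hag hBT hjump' hgt
  have hGs : ‖𝐆[fun x : E3 => aff x + ((if (∃ z ∈ Λ₀, x = t 1 + A z) then aT 1 else aT 0) + BT (x - (t 0 + A z₀)))]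
      (⟨t 0, t0_mem_sites⟩ : Sites₀ t A)‖ ≤ κ ^ 2 / 10 ^ 11 := by
    refine hGn.trans (le_trans ?_ hs₃)
    have hC : 0 ≤ Cˢ := by positivity
    exact add_le_add (mul_le_mul_of_nonneg_left hjump' hC) le_rfl
  -- (3) relaxation
  obtain ⟨ξ, hξ, haff', hrel'⟩ := exists_relaxed_field hA hI hκ0 hκ1 hκ
    (aff := fun x : E3 => aff x + ((if (∃ z ∈ Λ₀, x = t 1 + A z) then aT 1 else aT 0) + BT (x - (t 0 + A z₀))))
    (a := ag) (B := Bm + BT) (x₀ := c₀) hgt hB' hs' hGs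
  refine ⟨ξ, hjump, hξ.trans (mul_le_mul_of_nonneg_left hGn (by positivity)), fun m z hz => ?_, hrel'⟩
  rw [haff' m z hz]
  obtain hm | hm := (Fin.exists_fin_two.mp ⟨m, rfl⟩ : m = 0 ∨ m = 1)
  · rw [hm]; simp only [Matrix.cons_val_zero, hag 0]
  · rw [hm]; simp only [Matrix.cons_val_one, Matrix.cons_val_zero, hag 1]

/-- **The decay step** (see the module docstring).  `Θ₁, Θ₂` are the slope and Taylor coefficients of
`linear_decay` at `r' = 9ρ`; the smallness hypotheses `hs₁, hs₂, hs₃` (slope, jump and self-force below the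
relaxation thresholds) are discharged by the caller from the decay profile. [folklore] -/
theorem step_decay (hA : Adm₀ A) (hI : Inner₀ t A) (hκ0 : 0 < κ) (hκ1 : κ ≤ 1)
    (hκ : ∀ v : E3 → E3, (Function.support v).Finite → Function.support v ⊆ Sites₀ t A →
      κ * nnForm t A v ≤ ∑' p : Sites₀ t A, ⟪𝕃 v @ p, v p⟫)
    {h : E3 → E3} (hh : (Function.support h).Finite) {ρ : ℝ} (hρ : 64 ≤ ρ)
    (hrows : ∀ p : Sites₀ t A, dist (p : E3) c₀ ≤ 2 * (1280 * (9 * ρ) + 2388) + 4 → 𝕃 h @ p = 0)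
    {V J : ℝ} (hV : ∀ x ∈ Sites₀ t A, dist x c₀ ≤ 11 / 5 → ‖h x‖ ≤ V) (hJ : 𝐉[h, ρ] ≤ J)
    {aff : E3 → E3} {a : Fin 2 → E3} {Bm : E3 →L[ℝ] E3}
    (haff : ∀ (m : Fin 2) (z : E3), z ∈ Λ₀ → aff (t m + A z) = a m + Bm (t m + A z - c₀))
    (hrel : ∀ p : Sites₀ t A, 𝐆[aff] p = 0)
    (hBm : ‖Bm‖ ≤ κ / (2 * 10 ^ 10)) (ha : ‖a 0 - a 1‖ ≤ κ / (2 * 10 ^ 10))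
    {Θ₁ Θ₂ : ℝ}
    (hΘ₁ : 64 * 𝐋 ^ 3 / (9 * ρ) ^ 3 * (𝐋 * (𝐌[h, 4 * (1280 * (9 * ρ) + 2388) + 4] / (1280 * (9 * ρ) + 2388) ^ 2 +
        𝐉[h, 10 * (9 * ρ) + 10])) + 536 * 𝐋 ^ 3 * (9 * ρ) ^ 3 * 𝐉Δ[h, 10 * (9 * ρ) + 10] ≤ Θ₁)
    (hΘ₂ : 64 * 𝐋 ^ 4 / (9 * ρ) ^ 5 * (𝐋 * (𝐌[h, 4 * (1280 * (9 * ρ) + 2388) + 4] / (1280 * (9 * ρ) + 2388) ^ 2 +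
        𝐉[h, 10 * (9 * ρ) + 10])) + (64 * 𝐋 ^ 4 / (9 * ρ) ^ 3 + 3216 * 𝐋 ^ 4 * (9 * ρ) ^ 3) * 𝐉Δ[h, 10 * (9 * ρ) + 10] ≤ Θ₂)
    (hs₁ : 12 * Real.sqrt Θ₁ ≤ κ / (2 * 10 ^ 10))
    (hs₂ : 2 / κ * (38 * (1024 / ((23 / 25 : ℝ) ^ 3 * (23 / 25 : ℝ) ^ 4)) * (12 * Real.sqrt Θ₁) +
      38 * (1024 / ((23 / 25 : ℝ) ^ 3 * (23 / 25 : ℝ) ^ 3)) * (1428 * Real.sqrt Θ₂) +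
      38 * (1024 / ((23 / 25 : ℝ) ^ 3 * (ρ - 11 / 10) ^ 5)) * (V + 11 / 10 * (12 * Real.sqrt Θ₁)) +
      38 * (1024 / ((23 / 25 : ℝ) ^ 3 * (ρ - 11 / 10) ^ 4)) * (12 * Real.sqrt Θ₁) +
      38 * Real.sqrt (1024 / ((23 / 25 : ℝ) ^ 3 * (ρ - 11 / 10) ^ 5)) * Real.sqrt (39 * J)) ≤ κ / (2 * 10 ^ 10))
    (hs₃ : Cˢ * (κ / (2 * 10 ^ 10)) + Cᴮ * (12 * Real.sqrt Θ₁) ≤ κ ^ 2 / 10 ^ 11) (hΘ₂0 : 0 ≤ Θ₂) :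
    ∃ (z₀ : E3) (aT : Fin 2 → E3) (BT : E3 →L[ℝ] E3) (ξ : E3), z₀ ∈ Λ₀ ∧ dist (t 0 + A z₀) c₀ ≤ 11 / 10 ∧
      ‖BT‖ ≤ 12 * Real.sqrt Θ₁ ∧
      ‖aT 0 - aT 1‖ ≤ 2 / κ * (38 * (1024 / ((23 / 25 : ℝ) ^ 3 * (23 / 25 : ℝ) ^ 4)) * ‖BT‖ +
        38 * (1024 / ((23 / 25 : ℝ) ^ 3 * (23 / 25 : ℝ) ^ 3)) * (1428 * Real.sqrt Θ₂) +
        38 * (1024 / ((23 / 25 : ℝ) ^ 3 * (ρ - 11 / 10) ^ 5)) * (V + 11 / 10 * ‖BT‖) +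
        38 * (1024 / ((23 / 25 : ℝ) ^ 3 * (ρ - 11 / 10) ^ 4)) * ‖BT‖ +
        38 * Real.sqrt (1024 / ((23 / 25 : ℝ) ^ 3 * (ρ - 11 / 10) ^ 5)) * Real.sqrt (39 * J)) ∧
      (∀ m, ‖aT m‖ ≤ V + 11 / 10 * ‖BT‖) ∧
      ‖ξ‖ ≤ 4 / κ * (Cˢ * ‖aT 0 - aT 1‖ + Cᴮ * ‖BT‖) ∧
      (∀ (L : ℝ) (N : ℕ), 400 / 189 * (L + 11 / 5) ≤ N → 4 * (N : ℝ) + 11 ≤ 9 * ρ →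
        ∀ (m : Fin 2) (z : E3), z ∈ Λ₀ → dist (t m + A z) c₀ ≤ L →
          ‖h (t m + A z) - (aT m + BT (t m + A z - (t 0 + A z₀)))‖ ^ 2 ≤ 144 * (N : ℝ) ^ 4 * Θ₂) ∧
      (∀ x ∈ Sites₀ t A, x ≠ t 0 + A z₀ → dist x c₀ ≤ ρ →
        ‖h x - ((fun x : E3 => (if (∃ z ∈ Λ₀, x = t 1 + A z) then aT 1 else aT 0) + BT (x - (t 0 + A z₀))) x)‖ ≤
          1428 * Real.sqrt Θ₂ * (dist x (t 0 + A z₀)) ^ 2) ∧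
      (∀ (m : Fin 2) (z : E3), z ∈ Λ₀ →
        (fun x : E3 => aff x + ((if (∃ z ∈ Λ₀, x = t 1 + A z) then aT 1 else aT 0) + BT (x - (t 0 + A z₀))) +
          (if (∃ z ∈ Λ₀, x = t 0 + A z) then ξ else 0)) (t m + A z) =
          (![a 0 + aT 0 + BT (c₀ - (t 0 + A z₀)) + ξ, a 1 + aT 1 + BT (c₀ - (t 0 + A z₀))] : Fin 2 → E3) m +
            (Bm + BT) (t m + A z - c₀)) ∧
      (∀ p : Sites₀ t A, 𝐆[fun x : E3 => aff x + ((if (∃ z ∈ Λ₀, x = t 1 + A z) then aT 1 else aT 0) + BT (x - (t 0 + A z₀))) +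
          (if (∃ z ∈ Λ₀, x = t 0 + A z) then ξ else 0)] p = 0) := by
  obtain ⟨z₀, aT, BT, hz₀, hp₀c, hBT, ha0, hval, hT, htay, hpt⟩ :=
    step_decay_taylor hA hI hκ0 hκ hh hρ hrows hV hΘ₁ hΘ₂ hΘ₂0
  have hBn : 0 ≤ ‖BT‖ := norm_nonneg _
  have hBT' : ‖BT‖ ≤ κ / (2 * 10 ^ 10) := hBT.trans hs₁
  have hρ' : 0 < ρ - 11 / 10 := by linarith
  have hK : 0 ≤ 1428 * Real.sqrt Θ₂ := by positivity
  -- monotonicity of the jump bound in ‖BT‖ ≤ 12√Θ₁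
  have hs₂' : 2 / κ * (38 * (1024 / ((23 / 25 : ℝ) ^ 3 * (23 / 25 : ℝ) ^ 4)) * ‖BT‖ +
      38 * (1024 / ((23 / 25 : ℝ) ^ 3 * (23 / 25 : ℝ) ^ 3)) * (1428 * Real.sqrt Θ₂) +
      38 * (1024 / ((23 / 25 : ℝ) ^ 3 * (ρ - 11 / 10) ^ 5)) * (V + 11 / 10 * ‖BT‖) +
      38 * (1024 / ((23 / 25 : ℝ) ^ 3 * (ρ - 11 / 10) ^ 4)) * ‖BT‖ +
      38 * Real.sqrt (1024 / ((23 / 25 : ℝ) ^ 3 * (ρ - 11 / 10) ^ 5)) * Real.sqrt (39 * J)) ≤ κ / (2 * 10 ^ 10) := by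
    refine le_trans ?_ hs₂
    gcongr
  have hs₃' : Cˢ * (κ / (2 * 10 ^ 10)) + Cᴮ * ‖BT‖ ≤ κ ^ 2 / 10 ^ 11 := by
    refine le_trans ?_ hs₃
    gcongr
  have hrow0 : 𝕃 h @ (⟨t 0 + A z₀, add_mem_sites₀ t0_mem_sites hz₀⟩ : Sites₀ t A) = 0 :=
    hrows _ (hp₀c.trans (by linarith))
  obtain ⟨ξ, hjump, hξ, haff', hrel'⟩ := step_decay_relax hA hI hκ0 hκ1 hκ hh hρ hz₀ hp₀c hrow0 hJ haff hrel hBm ha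
    aT BT ha0 hK hval hT hpt hBT' hs₂' hs₃'
  exact ⟨z₀, aT, BT, ξ, hz₀, hp₀c, hBT, hjump, hval, hξ, htay, hpt, haff', hrel'⟩

end

end Summit.AtomisticToContinuum.Crystallization.Theorems.ExcessDecayLiouville

end
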